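import Mathlib.Analysis.SpecialFunctions.Pow.Real
import Mathlib.Analysis.SpecialFunctions.Sqrt
import Mathlib.Topology.Order.Lattice

/-!
# Route EIHFluxBalance — `InertialRecession`: meshing the flat profile with the hole profiles

Helper file for the crux `stmt-FinalStateConjecture-10166`
(`Summit.FinalStateConjecture.FinalStateConjecture.Theses.EIHFluxBalance.InertialRecession`).

The radiation-zone package with prescribed profile (`flat_radiationZone_package_of_profile`) wants a
continuous `R′ ≥ R₀` with `R′ → ∞`, `R′(t)/t → 0`, while the covering clause wants the flat domain
`{R′(x⁰) < ‖x̃ − ξᵢ(x⁰)‖}` to reach inside every hole chart's honest zone, i.e. `4R′ ≤ ρᵢ`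
eventually, for the finitely many hole profiles `ρᵢ → ∞` of `hole_chart_package`. Such an `R′`
exists: `R′ = max R₀ (min √t (minᵢ ρᵢ/4))` (`exists_meshing_profile'`, registered form unprimed). [folklore]
-/

noncomputable section

open Filter Set Topology

namespace Summit.FinalStateConjecture.FinalStateConjecture.Theorems

/-- **Meshing profile.** Given finitely many continuous profiles `ρᵢ → ∞` (`i : Fin N`, `N ≥ 1`) and
`R₀`, there is a continuous `R′ ≥ R₀` with `R′ → ∞`, `R′(t)/t → 0`, and `4 R′ ≤ ρᵢ` for all `i`
after some time `T`. [folklore] -/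
theorem exists_meshing_profile' {N : ℕ} (i₀ : Fin N) (ρ : Fin N → ℝ → ℝ) (hρc : ∀ i, Continuous (ρ i))
    (hρt : ∀ i, Tendsto (ρ i) atTop atTop) (R₀ : ℝ) :
    ∃ R' : ℝ → ℝ, Continuous R' ∧ (∀ t, R₀ ≤ R' t) ∧ Tendsto R' atTop atTop ∧
      Tendsto (fun t ↦ R' t / t) atTop (𝓝 0) ∧ ∃ T : ℝ, ∀ t, T ≤ t → ∀ i, 4 * R' t ≤ ρ i t := by
  have hne : (Finset.univ : Finset (Fin N)).Nonempty := ⟨i₀, Finset.mem_univ _⟩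
  set m : ℝ → ℝ := fun t ↦ Finset.univ.inf' hne fun i ↦ ρ i t / 4 with hm
  have hmc : Continuous m := Continuous.finset_inf'_apply hne fun i _ ↦ (hρc i).div_const 4
  have hmle : ∀ t i, m t ≤ ρ i t / 4 := fun t i ↦ Finset.inf'_le _ (Finset.mem_univ i)
  have hmt : Tendsto m atTop atTop := by
    refine tendsto_atTop.2 fun b ↦ ?_
    have h : ∀ i, ∀ᶠ t in atTop, b ≤ ρ i t / 4 := fun i ↦
      (Tendsto.atTop_div_const (by norm_num : (0 : ℝ) < 4) (hρt i)).eventually (eventually_ge_atTop b)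
    filter_upwards [eventually_all.2 h] with t ht
    exact Finset.le_inf' hne _ fun i _ ↦ ht i
  set s : ℝ → ℝ := fun t ↦ Real.sqrt (max t 0) with hs
  have hsc : Continuous s := (continuous_id.max continuous_const).sqrt
  have hst : Tendsto s atTop atTop :=
    Real.tendsto_sqrt_atTop.comp (tendsto_atTop_mono (fun t ↦ le_max_left t 0) tendsto_id)
  set R' : ℝ → ℝ := fun t ↦ max R₀ (min (s t) (m t)) with hR'
  have hmin : Tendsto (fun t ↦ min (s t) (m t)) atTop atTop := by
    refine tendsto_atTop.2 fun b ↦ ?_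
    filter_upwards [tendsto_atTop.1 hst b, tendsto_atTop.1 hmt b] with t h1 h2
    exact le_min h1 h2
  refine ⟨R', continuous_const.max (hsc.min hmc), fun t ↦ le_max_left _ _, ?_, ?_, ?_⟩
  · exact tendsto_atTop_mono (fun t ↦ le_max_right _ _) hmin
  · -- `|R′| ≤ |R₀| + √t` eventually, and `(√t + |R₀|)/t → 0`
    have h1 : Tendsto (fun t : ℝ ↦ Real.sqrt t / t) atTop (𝓝 0) := by
      simp_rw [Real.sqrt_div_self]
      exact tendsto_inv_atTop_zero.comp Real.tendsto_sqrt_atTop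
    have h2 : Tendsto (fun t : ℝ ↦ |R₀| / t) atTop (𝓝 0) := tendsto_const_nhds.div_atTop tendsto_id
    have h3 := h1.add h2
    rw [add_zero] at h3
    refine squeeze_zero_norm' ?_ h3
    filter_upwards [eventually_gt_atTop (0 : ℝ), tendsto_atTop.1 hmt 0] with t ht hm0
    have hst0 : s t = Real.sqrt t := by rw [hs]; simp only [max_eq_left ht.le]
    have hs0 : 0 ≤ s t := Real.sqrt_nonneg _
    have hb : |R' t| ≤ Real.sqrt t + |R₀| := by
      rw [hR']
      simp only
      rcases le_total R₀ (min (s t) (m t)) with h | h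
      · rw [max_eq_right h, abs_of_nonneg (le_min hs0 hm0), ← hst0]
        exact (min_le_left _ _).trans (le_add_of_nonneg_right (abs_nonneg _))
      · rw [max_eq_left h]
        exact le_add_of_nonneg_left (Real.sqrt_nonneg _)
    rw [Real.norm_eq_abs, abs_div, abs_of_pos ht, ← add_div]
    exact div_le_div_of_nonneg_right hb ht.le
  · have e1 : ∀ᶠ t in atTop, R₀ ≤ m t := tendsto_atTop.1 hmt R₀
    have e2 : ∀ᶠ t in atTop, R₀ ≤ s t := tendsto_atTop.1 hst R₀
    obtain ⟨T, hT⟩ := eventually_atTop.1 (e1.and e2)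
    refine ⟨T, fun t ht i ↦ ?_⟩
    obtain ⟨h1, h2⟩ := hT t ht
    have h3 : R' t = min (s t) (m t) := max_eq_right (le_min h2 h1)
    rw [h3]
    have := hmle t i
    have := min_le_right (s t) (m t)
    linarith

/-- Registered sub-goal form (stub `exists_meshing_profile` of the crux item) of
`exists_meshing_profile'`. [folklore] -/
theorem exists_meshing_profile : open Filter Topology in ∀ {N : ℕ}, Fin N → ∀ (ρ : Fin N → ℝ → ℝ), (∀ i, Continuous (ρ i)) → (∀ i, Tendsto (ρ i) atTop atTop) → ∀ R₀ : ℝ, ∃ R' : ℝ → ℝ, Continuous R' ∧ (∀ t, R₀ ≤ R' t) ∧ Tendsto R' atTop atTop ∧ Tendsto (fun t ↦ R' t / t) atTop (𝓝 0) ∧ ∃ T : ℝ, ∀ t, T ≤ t → ∀ i, 4 * R' t ≤ ρ i t :=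
  fun i₀ ρ hρc hρt R₀ ↦ exists_meshing_profile' i₀ ρ hρc hρt R₀

end Summit.FinalStateConjecture.FinalStateConjecture.Theorems

end
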